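import Literature.Computability.Complexity.Williams2014ValueCode
import HarnessLib

/-!
# Williams' generator `A` (Lemma 3.1), part 6: the machine `A` and `Williams2014_lemma_3_1`

R. Williams, *Nonuniform ACC circuit lower bounds*, J. ACM 61 (2014), Lemma 3.1 (pp. 10–12):
under "`P` has `ACC` circuits" and a fast `ACC`-SAT algorithm, a nondeterministic machine `A`
prints, on some computation path and never wrongly, `ACC` circuits `C'ₓ` computing the clause
map of the succinct reduction at `x`, within `O(2ⁿ/nᶜ + poly)` steps. This file assembles the
tree's `A` from its stages and proves the named fact `Williams2014_lemma_3_1`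
(`Williams2014Lemma31.lean`) from the existence of an `FP` function for the stage function
`stageA` of `Williams2014ValueCode.lean` (`Williams2014_lemma_3_1_of_stageA`; the `FP` function is
part 5, and the closed discharge follows it):

* `nGenerates_of_prefixMachine`: the `NGenerates` analogue of the prefix-verifier packaging
  (`mem_NTIME_of_prefixMachine_pre`, `Williams2014MachineB.lean`): a clock `x ↦ ⟨x, 1^{s x}⟩`, the
  truncating wrapper `truncMapAux` (so that long guesses cost linear time only), and a core machine
  on `⟨x, z⟩`, `|z| ≤ s x`, printing `ok :: out`;
* the core `M_F ▸ mapFstAux M_SAT ▸ M_fin`: the stage function (parse, validate, print VALUE and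
  `C'ₓ`), ONE call of the `ACC`-SAT machine on VALUE (only ever on the code of a `dnfCircuit` in the
  class on which it is specified: realised blocks of depth `≤ d + 1`, size `≤ q_E(n)`, fan-in at
  most the yardstick), and the formatter `ok ∧ ¬sat :: printout` (`finFun`, an `FP` function);
* soundness (`blockVal_out_eq_clauseMap`, `stageA_sound`), completeness (`exists_goodFamilies`,
  `stageA_complete`, injectivity of circuit codes `circuitCodeList_injOn`), and the running time
  `O(n + 2ⁿ/n)` (`williamsBound`; the SAT call at width `w = n + c log n + c` with exponent
  `k = c + 1`, `satTime_le_williamsBound`; everything else polynomial, `PolyBdd`).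

No new named fact is introduced.

## References

* R. Williams, *Nonuniform ACC circuit lower bounds*, J. ACM 61 (2014) 2:1–2:32, Lemma 3.1 and its
  proof (pp. 10–12) [Williams2014].
* S. Arora, B. Barak, *Computational Complexity: A Modern Approach*, CUP 2009, §1.3, §2.1
  (verifiers, clocks) [AroraBarakCC2009].
-/

noncomputable section

namespace Literature.Computability.Complexity

open Turing _root_.Computability Polynomial CodeFP Brick TM2Comp

namespace MachineA

open SatCode Tableau GateList WitnessCheck MachineB

attribute [local instance] Turing.FinTM2.kFin Turing.FinTM2.ΛFin Turing.FinTM2.σFin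
  Turing.FinTM2.Γk₀Fin

/-! ### Polynomially bounded functions -/

/-- `f` is bounded by a polynomial. [folklore] -/
def PolyBdd (f : ℕ → ℕ) : Prop := ∃ p : Polynomial ℕ, ∀ n, f n ≤ p.eval n

namespace PolyBdd

variable {f g : ℕ → ℕ}

/-- A polynomial is polynomially bounded. [folklore] -/
theorem poly (p : Polynomial ℕ) : PolyBdd fun n => p.eval n := ⟨p, fun _ => le_rfl⟩

/-- Constants. [folklore] -/
theorem const (k : ℕ) : PolyBdd fun _ => k := ⟨Polynomial.C k, fun _ => by simp⟩

/-- The identity. [folklore] -/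
theorem id : PolyBdd fun n => n := ⟨X, fun _ => by simp⟩

/-- Domination. [folklore] -/
theorem of_le (hg : PolyBdd g) (h : ∀ n, f n ≤ g n) : PolyBdd f := by
  obtain ⟨p, hp⟩ := hg; exact ⟨p, fun n => (h n).trans (hp n)⟩

/-- Sums. [folklore] -/
theorem add (hf : PolyBdd f) (hg : PolyBdd g) : PolyBdd fun n => f n + g n := by
  obtain ⟨p, hp⟩ := hf; obtain ⟨q, hq⟩ := hg
  exact ⟨p + q, fun n => by rw [eval_add]; exact Nat.add_le_add (hp n) (hq n)⟩

/-- Products. [folklore] -/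
theorem mul (hf : PolyBdd f) (hg : PolyBdd g) : PolyBdd fun n => f n * g n := by
  obtain ⟨p, hp⟩ := hf; obtain ⟨q, hq⟩ := hg
  exact ⟨p * q, fun n => by rw [eval_mul]; exact Nat.mul_le_mul (hp n) (hq n)⟩

/-- Post-composition with a polynomial. [folklore] -/
theorem comp (hf : PolyBdd f) (q : Polynomial ℕ) : PolyBdd fun n => q.eval (f n) := by
  obtain ⟨p, hp⟩ := hf
  exact ⟨q.comp p, fun n => by rw [eval_comp]; exact natPoly_eval_mono q (hp n)⟩

/-- A polynomially bounded function is `O(williamsBound)`. [folklore] -/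
theorem le_williamsBound (hf : PolyBdd f) : ∃ C, ∀ n, f n ≤ C * williamsBound n + C := by
  obtain ⟨p, hp⟩ := hf
  obtain ⟨C, hC⟩ := exists_poly_le_id_add_two_pow_div p
  exact ⟨C, fun n => (hp n).trans (hC n)⟩

/-- A polynomially bounded function is below `n ^ e + e`. [folklore] -/
theorem le_pow_add (hf : PolyBdd f) : ∃ e, ∀ n, f n ≤ n ^ e + e := by
  obtain ⟨p, hp⟩ := hf
  obtain ⟨e, he⟩ := exists_eval_le_pow_add_self p
  exact ⟨e, fun n => (hp n).trans (he n)⟩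

end PolyBdd

/-! ### The numerology is polynomial -/

section Bounds

variable (c m : ℕ) (M : TM2ComputableAux Bool Bool) (pT qE : Polynomial ℕ)

/-- `w = succinctWidth c n` is polynomially bounded. [folklore] -/
theorem polyBdd_width : PolyBdd (succinctWidth c) :=
  ⟨widthPoly c, succinctWidth_le_widthPoly c⟩

/-- `|x'|` is polynomially bounded. [folklore] -/
theorem polyBdd_nX : PolyBdd (nX c) := by
  unfold nX
  exact (((PolyBdd.const 2).mul PolyBdd.id).add ((PolyBdd.const 2).mul (polyBdd_width c))).add (PolyBdd.const 21)

/-- `T` is polynomially bounded. [folklore] -/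
theorem polyBdd_TT : PolyBdd (TT c pT) := by
  unfold TT
  exact ((((PolyBdd.const 2).mul (polyBdd_nX c)).add (PolyBdd.const 2)).add (polyBdd_width c)).comp pT

/-- `S₁` is polynomially bounded. [folklore] -/
theorem polyBdd_S1 : PolyBdd fun n => S1 M (nX c n) (succinctWidth c n) (TT c pT n) := by
  have : ∀ n, S1 M (nX c n) (succinctWidth c n) (TT c pT n) =
      2 * nX c n + 2 + succinctWidth c n + dM M * TT c pT n + 3 * dM M := fun n => rfl
  simp_rw [this]
  exact (((((PolyBdd.const 2).mul (polyBdd_nX c)).add (PolyBdd.const 2)).add (polyBdd_width c)).add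
    ((PolyBdd.const _).mul (polyBdd_TT c pT))).add (PolyBdd.const _)

/-- `NV` is polynomially bounded. [folklore] -/
theorem polyBdd_NVn : PolyBdd (NVn c M pT) := by
  unfold NVn Rn RBn RB
  exact (((polyBdd_TT c pT).add (PolyBdd.const 1)).mul ((polyBdd_S1 c M pT).add (PolyBdd.const 1))).mul
    (PolyBdd.const _)

/-- `nFam` is polynomially bounded. [folklore] -/
theorem polyBdd_nFam : PolyBdd (nFam c) := by
  unfold nFam
  exact (PolyBdd.const 2).mul ((PolyBdd.const 3).mul ((polyBdd_width c).add (PolyBdd.const 2)))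

/-- The clause-count bound is polynomially bounded. [folklore] -/
theorem polyBdd_clausesBound :
    PolyBdd fun n => clausesBound M (nX c n) (succinctWidth c n) (TT c pT n) := by
  unfold clausesBound NN
  refine ((((((PolyBdd.const 2).mul (polyBdd_nX c)).add ?_).add ?_).add ?_).add (PolyBdd.const 1))
  · exact ((PolyBdd.const 3).add ((PolyBdd.const 2).mul (polyBdd_width c))).add
      (((PolyBdd.const _).mul (polyBdd_TT c pT)).add (PolyBdd.const _))
  · refine (polyBdd_TT c pT).mul ((((PolyBdd.const _).add ?_)).add (PolyBdd.const _))
    exact (((((PolyBdd.const 2).mul (polyBdd_nX c)).add (PolyBdd.const 2)).add (polyBdd_width c)).add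
      ((PolyBdd.const _).mul (polyBdd_TT c pT))).mul (PolyBdd.const _)
  · exact (((polyBdd_TT c pT).add (PolyBdd.const 1)).mul ((polyBdd_S1 c M pT).add (PolyBdd.const 1))).mul
      (PolyBdd.const _)

/-- **The number of terms of VALUE** at input length `n`. [folklore] -/
def termsLen (n : ℕ) : ℕ :=
  nFam c n * (clausesBound M (nX c n) (succinctWidth c n) (TT c pT n) + 2 * succinctWidth c n)

/-- `|allTerms x| ≤ termsLen |x|`. [folklore] -/
theorem length_allTerms_le (x : List Bool) : (allTerms M c pT x).length ≤ termsLen c M pT x.length := by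
  unfold allTerms termsLen
  rw [List.length_flatMap]
  calc ((List.range (nFam c x.length)).map fun φ => (famTerms M c pT x φ).length).sum
      ≤ ((List.range (nFam c x.length)).map fun _ =>
          clausesBound M (nX c x.length) (succinctWidth c x.length) (TT c pT x.length) +
            2 * succinctWidth c x.length).sum := by
        refine List.sum_le_sum fun φ hφ => ?_
        rw [List.mem_range] at hφ
        have hp : φ / 2 < 3 * (succinctWidth c x.length + 2) := by unfold nFam at hφ; omega
        unfold famTerms
        rw [List.length_append, List.length_map, List.length_flatMap]
        refine Nat.add_le_add ?_ (le_of_eq ?_)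
        · have := length_clauses_le M (P := succinctWidth c x.length) (T := TT c pT x.length)
            (xq' c x (φ / 2) (decide (φ % 2 = 1)))
          rwa [length_xq' c x hp] at this
        · simp [pinTerms, List.sum_replicate]
          ring
    _ = nFam c x.length * (clausesBound M (nX c x.length) (succinctWidth c x.length) (TT c pT x.length) +
          2 * succinctWidth c x.length) := by
        rw [List.map_const', List.sum_replicate, smul_eq_mul, List.length_range]

/-- `termsLen` is polynomially bounded. [folklore] -/
theorem polyBdd_termsLen : PolyBdd (termsLen c M pT) := by
  unfold termsLen
  exact (polyBdd_nFam c).mul ((polyBdd_clausesBound c M pT).add ((PolyBdd.const 2).mul (polyBdd_width c)))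

/-- **Terms are narrow**: at most `cw + 1` literals. [folklore] -/
theorem length_le_of_mem_allTerms {x : List Bool} {t : List Lit} (ht : t ∈ allTerms M c pT x) :
    t.length ≤ cw M + 1 := by
  classical
  have hcw : 2 ≤ cw M := by unfold cw; have := one_le_dM M; omega
  unfold allTerms at ht
  obtain ⟨φ, -, ht⟩ := List.mem_flatMap.1 ht
  unfold famTerms at ht
  rcases List.mem_append.1 ht with ht | ht
  · obtain ⟨C, hC, rfl⟩ := List.mem_map.1 ht
    have := width_le_of_mem_clauses M hC
    simp only [clauseTerm, List.length_cons, List.length_append, List.length_map]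
    omega
  · obtain ⟨j, -, ht⟩ := List.mem_flatMap.1 ht
    simp only [pinTerms, List.mem_cons, List.mem_nil_iff, or_false] at ht
    rcases ht with rfl | rfl <;> simp <;> omega

/-- **The length of the code of a family list** with `nF` families of `NV` circuits of size
`≤ s` and fan-in `≤ φ` on `w` inputs. [folklore] -/
def guessLen (w nF NV s φ : ℕ) : ℕ :=
  2 * nF + 2 + nF * (2 * (2 * NV + 2 + NV * (2 * codeLen w s φ + 2)) + 2)

/-- The length of `listE e l` with items of length `≤ B`. [folklore] -/
theorem length_listE_le {α : Type} (e : α → List Bool) {l : List α} {B : ℕ} (h : ∀ a ∈ l, (e a).length ≤ B) :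
    (listE e l).length ≤ 2 * l.length + 2 + l.length * (2 * B + 2) := by
  rw [show listE e l = boolPair (unE l.length) (rawE e l) from rfl, length_boolPair, length_unE, length_rawE]
  have : (l.map fun a => 2 * (e a).length + 2).sum ≤ (l.map fun _ => 2 * B + 2).sum :=
    List.sum_le_sum fun a ha => by have := h a ha; omega
  rw [List.map_const', List.sum_replicate, smul_eq_mul] at this
  omega

/-- **The genuine guess is short**: the code of `nF` families of `NV` circuits on `w` inputs of
size `≤ s` and fan-in `≤ φ` has length `≤ guessLen w nF NV s φ`. [folklore] -/
theorem length_guess_le {w nF NV s φ : ℕ} (m : ℕ) (fams : List (List (Circuit (Fin w))))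
    (hlen : fams.length = nF) (hfam : ∀ f ∈ fams, f.length = NV ∧ ∀ C ∈ f, C.size ≤ s ∧ C.maxFanIn ≤ φ) :
    (listE (listE (listE natE)) (fams.map fun f => f.map (circuitCodeList m))).length ≤ guessLen w nF NV s φ := by
  have hitem : ∀ f ∈ fams, (listE (listE natE) (f.map (circuitCodeList m))).length ≤
      2 * NV + 2 + NV * (2 * codeLen w s φ + 2) := by
    intro f hf
    obtain ⟨hfl, hC⟩ := hfam f hf
    have h := length_listE_le (listE natE) (l := f.map (circuitCodeList m)) (B := codeLen w s φ) fun l hl => by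
      obtain ⟨C, hCf, rfl⟩ := List.mem_map.1 hl
      have := length_encodeAccCircuit_le m C (hC C hCf).1 (hC C hCf).2
      rwa [encodeAccCircuit, show (encodingListNatBool : Encoding (List ℕ) Bool) = encodingNatBool.listBool from rfl,
        listE_eq, natE_eq] at this
    rw [List.length_map, hfl] at h
    exact h
  have h := length_listE_le (listE (listE natE)) (l := fams.map fun f => f.map (circuitCodeList m))
    (B := 2 * NV + 2 + NV * (2 * codeLen w s φ + 2)) fun f' hf' => by
    obtain ⟨f, hf, rfl⟩ := List.mem_map.1 hf'
    exact hitem f hf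
  rw [List.length_map, hlen] at h
  exact h

/-- **The yardstick** of `A` at input length `n`: the length bound of the genuine guess
(families of circuits of size `≤ qE(n)`, fan-in `≤ m (w + qE(n))`). [folklore] -/
def yard (n : ℕ) : ℕ :=
  guessLen (succinctWidth c n) (nFam c n) (NVn c M pT n) (qE.eval n)
    (m * (succinctWidth c n + qE.eval n))

/-- `codeLen` is polynomial in its arguments. [folklore] -/
theorem polyBdd_codeLen {w s φ : ℕ → ℕ} (hw : PolyBdd w) (hs : PolyBdd s) (hφ : PolyBdd φ) :
    PolyBdd fun n => codeLen (w n) (s n) (φ n) := by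
  unfold codeLen
  exact (PolyBdd.const 2).add (((PolyBdd.const 4).add (hs.mul (((PolyBdd.const 2).mul hφ).add
    (PolyBdd.const 2)))).mul (((PolyBdd.const 2).mul ((hw.add hs).add hφ)).add (PolyBdd.const 14)))

/-- The yardstick is polynomially bounded. [folklore] -/
theorem polyBdd_yard : PolyBdd (yard c m M pT qE) := by
  unfold yard guessLen
  have hq : PolyBdd fun n => qE.eval n := PolyBdd.poly qE
  have hφ : PolyBdd fun n => m * (succinctWidth c n + qE.eval n) := (PolyBdd.const m).mul ((polyBdd_width c).add hq)
  have hcl := polyBdd_codeLen (polyBdd_width c) hq hφ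
  have hNV := polyBdd_NVn c M pT
  have hnF := polyBdd_nFam c
  exact (((PolyBdd.const 2).mul hnF).add (PolyBdd.const 2)).add (hnF.mul (((PolyBdd.const 2).mul
    ((((PolyBdd.const 2).mul hNV).add (PolyBdd.const 2)).add (hNV.mul (((PolyBdd.const 2).mul hcl).add
      (PolyBdd.const 2))))).add (PolyBdd.const 2)))

/-- **The size bound of VALUE** at input length `n`. [folklore] -/
def sizeBd (n : ℕ) : ℕ :=
  nFam c n * NVn c M pT n * qE.eval n + 2 + nFam c n * NVn c M pT n + succinctWidth c n + termsLen c M pT n + 1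

/-- **The fan-in bound of VALUE** at input length `n` (guessed blocks cut at the yardstick `yp`,
genuine blocks of fan-in `≤ m (w + qE n)`, terms, their number). [folklore] -/
def fanBd (yp : Polynomial ℕ) (n : ℕ) : ℕ :=
  yp.eval n + m * (succinctWidth c n + qE.eval n) + (cw M + 1) + termsLen c M pT n + 1

/-- The size bound is polynomially bounded. [folklore] -/
theorem polyBdd_sizeBd : PolyBdd (sizeBd c M pT qE) := by
  unfold sizeBd
  have hq : PolyBdd fun n => qE.eval n := PolyBdd.poly qE
  exact (((((((polyBdd_nFam c).mul (polyBdd_NVn c M pT)).mul hq).add (PolyBdd.const 2)).add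
    ((polyBdd_nFam c).mul (polyBdd_NVn c M pT))).add (polyBdd_width c)).add (polyBdd_termsLen c M pT)).add
    (PolyBdd.const 1)

/-- The fan-in bound is polynomially bounded. [folklore] -/
theorem polyBdd_fanBd (yp : Polynomial ℕ) : PolyBdd (fanBd c m M pT qE yp) := by
  unfold fanBd
  have hq : PolyBdd fun n => qE.eval n := PolyBdd.poly qE
  exact ((((PolyBdd.poly yp).add ((PolyBdd.const m).mul ((polyBdd_width c).add hq))).add
    (PolyBdd.const _)).add (polyBdd_termsLen c M pT)).add (PolyBdd.const 1)

/-- **The class exponent**: `sizeBd n, fanBd n ≤ w ^ e + e` for one `e` (`n ≤ w`). [folklore] -/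
theorem exists_classExp (yp : Polynomial ℕ) : ∃ e : ℕ, ∀ n, sizeBd c M pT qE n ≤ succinctWidth c n ^ e + e ∧
    fanBd c m M pT qE yp n ≤ succinctWidth c n ^ e + e := by
  obtain ⟨e, he⟩ := ((polyBdd_sizeBd c M pT qE).add (polyBdd_fanBd c m M pT qE yp)).le_pow_add
  refine ⟨e, fun n => ?_⟩
  have h := he n
  have hw : n ^ e ≤ succinctWidth c n ^ e := Nat.pow_le_pow_left (le_succinctWidth c n) e
  constructor <;> omega

variable {c m M pT qE}

/-- **VALUE on blocks in the class is in the class.** For blocks over `accBasis m` of depth `≤ dE`,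
size `≤ qE n`, fan-in `≤ φ` with `φ ≤ yard n + m (w + qE n)`, at most `nFam · NV` of them, and the
terms `allTerms x` (or none), `dnfCircuit` is over `accBasis m`, of depth `≤ max dE 1 + 2`, size
`≤ sizeBd n` and fan-in `≤ fanBd n`. [folklore] -/
theorem dnfCircuit_class {dE : ℕ} {yp : Polynomial ℕ} (x : List Bool)
    (blocks : List (Circuit (Fin (succinctWidth c x.length)))) {φ : ℕ}
    (hB : ∀ C ∈ blocks, C.IsOver (accBasis m) ∧ C.acDepth ≤ dE ∧ C.size ≤ qE.eval x.length ∧ C.maxFanIn ≤ φ)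
    (hφ : φ ≤ yp.eval x.length + m * (succinctWidth c x.length + qE.eval x.length))
    (hlen : blocks.length ≤ nFam c x.length * NVn c M pT x.length)
    (terms : List (List Lit)) (hterms : terms = allTerms M c pT x ∨ terms = []) :
    (dnfCircuit blocks terms).IsOver (accBasis m) ∧ (dnfCircuit blocks terms).acDepth ≤ max dE 1 + 2 ∧
      (dnfCircuit blocks terms).size ≤ sizeBd c M pT qE x.length ∧
      (dnfCircuit blocks terms).maxFanIn ≤ fanBd c m M pT qE yp x.length := by
  have htl : terms.length ≤ termsLen c M pT x.length := by
    rcases hterms with rfl | rfl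
    · exact length_allTerms_le c M pT x
    · exact Nat.zero_le _
  have htw : ∀ t ∈ terms, t.length ≤ cw M + 1 := by
    rcases hterms with rfl | rfl
    · exact fun t ht => length_le_of_mem_allTerms c M pT ht
    · simp
  refine ⟨isOver_dnfCircuit blocks terms fun C hC => (hB C hC).1,
    acDepth_dnfCircuit_le terms fun C hC => (hB C hC).2.1, ?_, ?_⟩
  · rw [size_dnfCircuit, sizeBd]
    have hsum : (blocks.map Circuit.size).sum ≤ nFam c x.length * NVn c M pT x.length * qE.eval x.length := by
      calc (blocks.map Circuit.size).sum ≤ (blocks.map fun _ => qE.eval x.length).sum :=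
            List.sum_le_sum fun C hC => (hB C hC).2.2.1
        _ = blocks.length * qE.eval x.length := by rw [List.map_const', List.sum_replicate, smul_eq_mul]
        _ ≤ _ := Nat.mul_le_mul_right _ hlen
    omega
  · refine maxFanIn_dnfCircuit_le blocks terms (K := fanBd c m M pT qE yp x.length) (by unfold fanBd; omega)
      (fun C hC => (hB C hC).2.2.2.trans (by unfold fanBd; omega)) (fun t ht => (htw t ht).trans (by unfold fanBd; omega))
      (htl.trans (by unfold fanBd; omega))

end Bounds

/-! ### The `NGenerates` packaging -/

/-- **Nondeterministic generation by a prefix-reading machine behind a clock** (the `NGenerates`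
form of `mem_NTIME_of_prefixMachine_pre`): if a clock prints `⟨x, 1^{s x}⟩` within `τ₁ x` steps, a
core machine prints `ok₀ x z :: out₀ x z` on `⟨x, z⟩`, `|z| ≤ s x`, within `τ₂ x` steps, accepted
outputs are good, some short `z` is accepted, and `τ₁ + τ₂ + s + |x| = O(t)`, then the property is
nondeterministically generated in time `O(t)`: the machine `truncMapAux clock ▸ core` reads only
the first `s x` guessed bits (`outputsWithin_truncMapAux_boolPair`), so every guess costs linear
time. [cite: AroraBarakCC2009, §2.1 (verifiers and clocks)] -/
theorem nGenerates_of_prefixMachine {t : ℕ → ℕ} {P : List Bool → List Bool → Prop}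
    (s : List Bool → ℕ) (ok₀ : List Bool → List Bool → Bool) (out₀ : List Bool → List Bool → List Bool)
    (N M₀ : TM2ComputableAux Bool Bool) (τ₁ τ₂ : List Bool → ℕ)
    (hN : ∀ x, N.OutputsWithin x (boolPair x (List.replicate (s x) true)) (τ₁ x))
    (hM₀ : ∀ x z, z.length ≤ s x → M₀.OutputsWithin (boolPair x z) (ok₀ x z :: out₀ x z) (τ₂ x))
    (hsound : ∀ x z, z.length ≤ s x → ok₀ x z = true → P x (out₀ x z))
    (hcompl : ∀ x, ∃ z, z.length ≤ s x ∧ ok₀ x z = true)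
    (C : ℕ) (hτ : ∀ x, τ₁ x + τ₂ x + s x + x.length ≤ C * t x.length + C) :
    NGenerates t P := by
  refine ⟨5 * C + 11, fun x y => ok₀ x (y.take (s x)), fun x y => out₀ x (y.take (s x)),
    (truncMapAux N).comp M₀, fun x y => ?_, fun x y hy => ?_, fun x => ?_⟩
  · have h₁ := outputsWithin_truncMapAux_boolPair N (y := y) (hN x)
    simp only [List.length_replicate] at h₁
    have h₂ := hM₀ x (y.take (s x)) (List.length_take_le _ _)
    have h := TM2ComputableAux.comp_outputsWithin _ _ h₁ h₂
    refine h.mono ?_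
    have hτx := hτ x
    have hy2 : y.length / 2 ≤ y.length := Nat.div_le_self _ _
    set F := t x.length with hF
    have e2 : (5 * C + 11) * (F + y.length) = 5 * (C * F) + 11 * F + (5 * C + 11) * y.length := by ring
    have e3 : y.length ≤ (5 * C + 11) * y.length := Nat.le_mul_of_pos_left _ (by omega)
    omega
  · exact hsound x _ (List.length_take_le _ _) hy
  · obtain ⟨z, hz, hok⟩ := hcompl x
    refine ⟨z, ?_, by show ok₀ x (z.take (s x)) = true; rwa [List.take_of_length_le hz]⟩
    have hτx := hτ x
    have e2 : (5 * C + 11) * t x.length = 5 * (C * t x.length) + 11 * t x.length := by ring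
    omega

/-! ### The packed stage output and the formatter -/

/-- The packed output of the stage function: `⟨listE natE code, ⟨[ok], listE (listE natE) print⟩⟩`.
[folklore] -/
def packA (r : List ℕ × Bool × List (List ℕ)) : List Bool :=
  boolPair (listE natE r.1) (boolPair [r.2.1] (listE (listE natE) r.2.2))

/-- **The stage-`F` hypothesis of `A`**: an everywhere-defined string function computing the packed
stage function on pairs. [folklore] -/
def StageAFn (c m : ℕ) (M : TM2ComputableAux Bool Bool) (pT : Polynomial ℕ) (dE : ℕ) (qE : Polynomial ℕ)
    (F : List Bool → List Bool) : Prop :=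
  ∀ x z, F (boolPair x z) = packA (stageA c m M pT dE qE x z)

/-- **The formatter** after the SAT call: `⟨b̂, ⟨ô, p⟩⟩ ↦ (ô = [1] ∧ b̂ = [0]) :: p`. [folklore] -/
def finFun (v : List Bool) : List Bool :=
  (decide (fstF (sndF v) = [true]) && decide (fstF v = [false])) :: sndF (sndF v)

/-- The formatter on a genuine input. [folklore] -/
theorem finFun_apply (b ok : Bool) (pr : List Bool) :
    finFun (boolPair [b] (boolPair [ok] pr)) = (ok && !b) :: pr := by
  simp only [finFun, fstF_boolPair, sndF_boolPair, List.cons.injEq, and_true]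
  cases ok <;> cases b <;> simp

/-- **The formatter is polynomial time** (an `FP` function via the calculus). [folklore] -/
theorem exists_finMachine : ∃ (MG : TM2ComputableAux Bool Bool) (pG : Polynomial ℕ),
    ∀ v, MG.OutputsWithin v (finFun v) (pG.eval v.length) := by
  have h1 : CodeFP strE strE fstF := of_fn fstF fstF_mem_FP fun _ => rfl
  have h2 : CodeFP strE strE sndF := of_fn sndF sndF_mem_FP fun _ => rfl
  have hinj : Function.Injective strE := fun _ _ h => h
  have hok := (CodeFP.eq hinj).comp ((h1.comp h2).pair (SatCode.cst strE strE [true]))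
  have hb := (CodeFP.eq hinj).comp (h1.pair (SatCode.cst strE strE [false]))
  have hbit := hok.and hb
  have hbit' : CodeFP strE strE (fun v => [decide (fstF (sndF v) = [true]) && decide (fstF v = [false])]) :=
    hbit.recodeOut fun _ => rfl
  have hmain := strAppend.comp (hbit'.pair (h2.comp h2))
  obtain ⟨G, ⟨pG, MG, hMG⟩, hG⟩ := hmain
  refine ⟨MG, pG, fun v => ?_⟩
  have := hMG v
  rwa [show G v = finFun v from hG v] at this

/-! ### Positions of coordinates -/

/-- The coordinate at position `p` has position `p`. [folklore] -/
theorem coordPos_getElem_clauseCoordList {w : ℕ} (p : ℕ) (hp : p < (clauseCoordList w).length) :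
    coordPos (clauseCoordList w)[p] = p := by
  have hp' : p < 3 * (w + 2) := by rwa [length_clauseCoordList] at hp
  have h := getElem_clauseCoordList_coordPos (coordOf ⟨p, hp'⟩ : ClauseCoord w)
  have e : coordPos (coordOf ⟨p, hp'⟩ : ClauseCoord w) = p := coordPos_coordOf _
  simp only [e] at h
  rw [h, e]

end MachineA

/-! ### The machine `A` -/

open MachineA SatCode Tableau GateList WitnessCheck MachineB in
/-- **Williams 2014, Lemma 3.1, from the stage function.** If for all parameters the packed stage
function `stageA` is computed on pairs by an `FP` function, then `Williams2014_lemma_3_1` holds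
(exponent `k = c + 1`): for `L` with a succinct reduction `cl` of constant `c`, modulus `m ≥ 2`,
`PHasAccCircuits m d` and `ACC`-SAT algorithms in time `O(2ⁿ/n^{c+1})`, the machine
`truncMapAux clock ▸ M_F ▸ mapFstAux M_SAT ▸ M_fin` nondeterministically generates the clause
circuits `C'ₓ` (`GoodClauseCircuits c cl m (d + 1) e_G`) in time `O(n + 2ⁿ/n)`.
[cite: Williams2014, Lemma 3.1 (proof, pp. 10–12)] -/
theorem Williams2014_lemma_3_1_of_stageA
    (hF : ∀ (c m : ℕ) (M : TM2ComputableAux Bool Bool) (pT : Polynomial ℕ) (dE : ℕ) (qE : Polynomial ℕ),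
      ∃ F : List Bool → List Bool, F ∈ FP ∧ StageAFn c m M pT dE qE F) :
    Williams2014_lemma_3_1 := by
  intro c
  refine ⟨c + 1, fun L cl m d hred hm hP hsat => ?_⟩
  have hm1 : 1 ≤ m := by omega
  -- the clause-bit machine and the good families
  obtain ⟨M, pT, hM⟩ := exists_bitMachine hred.polyTimeComputable
  obtain ⟨qE, hgood⟩ := exists_goodFamilies (M := M) (cl := cl) (by omega) hP hM c
  -- the stage function, the formatter, the SAT machine
  obtain ⟨F, ⟨pF, MF, hMF⟩, hFst⟩ := hF c m M pT (d + 1) qE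
  obtain ⟨MG, pG, hMG⟩ := exists_finMachine
  -- the yardstick polynomial and its clock
  obtain ⟨yp, hyp⟩ := polyBdd_yard c m M pT qE
  have hpre : fanoutFn id (Plumb.polyFn yp) ∈ FP :=
    fanoutFn_mem_FP OracleCompose.id_mem_FP (Plumb.polyFn_mem_FP _)
  obtain ⟨pP, MP, hMP⟩ := hpre
  -- the class of the instances and the SAT machine
  obtain ⟨eD, heD⟩ := exists_classExp c m M pT qE yp
  obtain ⟨cS, MS, hMS⟩ := hsat (max (d + 1) 1 + 2) eD
  -- the exponent of the printed circuits
  obtain ⟨eG, heG⟩ := ((PolyBdd.poly qE).add (PolyBdd.poly yp)).le_pow_add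
  -- abbreviations
  set D : (x z : List Bool) → Circuit (Fin (succinctWidth c x.length)) := fun x z =>
    dnfCircuit (blocksA c m M pT (d + 1) qE x z) (termsA c M pT (d + 1) qE x z) with hD
  set ok₀ : List Bool → List Bool → Bool := fun x z =>
    okA c M pT (d + 1) qE x z && !decide (D x z).Satisfiable with hok₀
  set out₀ : List Bool → List Bool → List Bool := fun x z =>
    listE (listE natE) (printA c m M pT (d + 1) qE x z) with hout₀
  -- the class of the instance
  have hDclass : ∀ x z, z.length ≤ yp.eval x.length →
      (D x z).IsOver (accBasis m) ∧ (D x z).acDepth ≤ max (d + 1) 1 + 2 ∧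
        (D x z).size ≤ succinctWidth c x.length ^ eD + eD ∧ (D x z).maxFanIn ≤ succinctWidth c x.length ^ eD + eD := by
    intro x z hz
    have h := dnfCircuit_class (c := c) (m := m) (M := M) (pT := pT) (qE := qE) (dE := d + 1) (yp := yp) x
      (blocksA c m M pT (d + 1) qE x z) (φ := z.length)
      (fun C hC => blocksA_class x z C hC) (hz.trans (Nat.le_add_right _ _)) ?_ (termsA c M pT (d + 1) qE x z) ?_
    · exact ⟨h.1, h.2.1, h.2.2.1.trans (heD x.length).1, h.2.2.2.trans (heD x.length).2⟩
    · by_cases hok : okA c M pT (d + 1) qE x z = true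
      · exact le_of_eq ((stageA_sound x z).2 hok).2.1
      · unfold blocksA; rw [if_neg hok]; exact Nat.zero_le _
    · by_cases hok : okA c M pT (d + 1) qE x z = true
      · exact Or.inl (by rw [termsA, if_pos hok])
      · exact Or.inr (by rw [termsA, if_neg hok])
  -- the output-length bound of stage `F`
  set LF : ℕ → ℕ := fun n => 2 * n + 2 + yp.eval n + machinePushBound MF.tm * pF.eval (2 * n + 2 + yp.eval n)
    with hLF
  set τ₂ : List Bool → ℕ := fun x =>
    pF.eval (2 * x.length + 2 + yp.eval x.length) +
      ((pG.eval (4 + LF x.length)) +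
        (cS * (2 ^ succinctWidth c x.length / succinctWidth c x.length ^ (c + 1)) + cS + 3 * 1 +
          2 * LF x.length + 6)) with hτ₂
  -- the core machine
  have hcore : ∀ x z, z.length ≤ yp.eval x.length →
      (MF.comp ((mapFstAux MS).comp MG)).OutputsWithin (boolPair x z) (ok₀ x z :: out₀ x z) (τ₂ x) := by
    intro x z hz
    have hsnd := stageA_sound (c := c) (m := m) (M := M) (pT := pT) (dE := d + 1) (qE := qE) x z
    have hFa : F (boolPair x z) = boolPair (encodeAccCircuit m (D x z))
        (boolPair [okA c M pT (d + 1) qE x z] (out₀ x z)) := by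
      rw [hFst x z, packA, stageA, encodeAccCircuit_eq_listE, ← hsnd.1]; rfl
    -- stage F
    have h1 : MF.OutputsWithin (boolPair x z) (F (boolPair x z)) (pF.eval (boolPair x z).length) := hMF _
    have hFm : pF.eval (boolPair x z).length ≤ pF.eval (2 * x.length + 2 + yp.eval x.length) := by
      rw [length_boolPair]; exact natPoly_eval_mono pF (by omega)
    have hlenF : (F (boolPair x z)).length ≤ LF x.length := by
      have hl : (F (boolPair x z)).length ≤ (boolPair x z).length + machinePushBound MF.tm * pF.eval (boolPair x z).length :=
        h1.length_le
      have hmul := Nat.mul_le_mul_left (machinePushBound MF.tm) hFm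
      have hN₀ : (boolPair x z).length = 2 * x.length + 2 + z.length := length_boolPair _ _
      simp only [hLF]
      omega
    -- the SAT call behind `mapFstAux`
    obtain ⟨hO, hd', hs', hf'⟩ := hDclass x z hz
    have hS := hMS (succinctWidth c x.length) (D x z) hO hd' hs' hf'
    have h2 := outputsWithin_mapFstAux MS (z := F (boolPair x z)) (by rw [hFa, boolUnpair_boolPair]; exact hS)
    rw [hFa, readRest_boolPair] at h2
    rw [← hFa] at h2
    -- the formatter
    have h3 := hMG (boolPair (encodeBool (decide (D x z).Satisfiable)) (boolPair [okA c M pT (d + 1) qE x z] (out₀ x z)))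
    rw [show encodeBool (decide (D x z).Satisfiable) = [decide (D x z).Satisfiable] from rfl, finFun_apply] at h3
    have h23 := TM2ComputableAux.comp_outputsWithin _ _ h2 h3
    have h123 := TM2ComputableAux.comp_outputsWithin _ _ h1 h23
    refine (show ok₀ x z :: out₀ x z = _ from rfl) ▸ h123.mono ?_
    -- time
    have hrest : (boolPair [okA c M pT (d + 1) qE x z] (out₀ x z)).length ≤ (F (boolPair x z)).length := by
      rw [hFa]; simp only [length_boolPair]; omega
    have hlen3 : (boolPair [decide (D x z).Satisfiable] (boolPair [okA c M pT (d + 1) qE x z] (out₀ x z))).length ≤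
        4 + LF x.length := by
      have e : (boolPair [decide (D x z).Satisfiable] (boolPair [okA c M pT (d + 1) qE x z] (out₀ x z))).length =
          4 + (boolPair [okA c M pT (d + 1) qE x z] (out₀ x z)).length := by
        rw [length_boolPair]; simp
      omega
    have hG := natPoly_eval_mono pG hlen3
    simp only [hτ₂, show (encodeBool (decide (D x z).Satisfiable)).length = 1 from rfl]
    omega
  -- the total time is `O(williamsBound)`
  have hbig : PolyBdd fun n => pP.eval n + (pF.eval (2 * n + 2 + yp.eval n) +
      (pG.eval (4 + LF n) + (3 + 2 * LF n + 6))) + yp.eval n + n := by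
    have hy : PolyBdd fun n => yp.eval n := PolyBdd.poly yp
    have h22 : PolyBdd fun n => 2 * n + 2 + yp.eval n := (((PolyBdd.const 2).mul PolyBdd.id).add (PolyBdd.const 2)).add hy
    have hLFb : PolyBdd LF := by
      simp only [hLF]
      exact h22.add ((PolyBdd.const _).mul (h22.comp pF))
    exact ((((PolyBdd.poly pP).add ((h22.comp pF).add ((((PolyBdd.const 4).add hLFb).comp pG).add
      (((PolyBdd.const 3).add ((PolyBdd.const 2).mul hLFb)).add (PolyBdd.const 6))))).add hy).add PolyBdd.id)
  obtain ⟨C₁, hC₁⟩ := hbig.le_williamsBound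
  refine ⟨d + 1, eG, nGenerates_of_prefixMachine (t := williamsBound)
    (fun x => yp.eval x.length) ok₀ out₀ MP (MF.comp ((mapFstAux MS).comp MG)) (fun x => pP.eval x.length) τ₂
    (fun x => by simpa [ones] using hMP x) hcore ?_ ?_ (C₁ + cS * 2 ^ c + cS) fun x => ?_⟩
  · -- soundness
    intro x z hz hok
    simp only [hok₀, Bool.and_eq_true, Bool.not_eq_true', decide_eq_false_iff_not] at hok
    obtain ⟨hokA, hunsatD⟩ := hok
    obtain ⟨hterms, -, hprint⟩ := (stageA_sound x z).2 hokA
    have hunsat : ∀ u, dnfVal (blocksA c m M pT (d + 1) qE x z) (allTerms M c pT x) u = false := by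
      intro u
      rw [← Bool.not_eq_true]
      intro hu
      apply hunsatD
      simp only [hD]
      rw [satisfiable_dnfCircuit_iff, hterms]
      exact ⟨u, hu⟩
    have hidx : ∀ κ : ClauseCoord (succinctWidth c x.length),
        outIdx c M pT x.length (coordPos κ) < (blocksA c m M pT (d + 1) qE x z).length :=
      fun κ => (hprint (coordPos κ) (coordPos_lt κ)).1
    refine ⟨fun κ => (blocksA c m M pT (d + 1) qE x z)[outIdx c M pT x.length (coordPos κ)]'(hidx κ),
      fun κ => ?_, ?_⟩
    · obtain ⟨hO, hdp, hsz, hfan⟩ := blocksA_class x z _ (List.getElem_mem (hidx κ))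
      have hG : qE.eval x.length + yp.eval x.length ≤ x.length ^ eG + eG := heG x.length
      refine ⟨hO, hdp, hsz.trans (by omega), hfan.trans (by omega), fun i => ?_⟩
      have h := blockVal_out_eq_clauseMap hM c x (blocksA c m M pT (d + 1) qE x z) hunsat κ i
      rw [blockVal, dif_pos (hidx κ)] at h
      exact h
    · simp only [hout₀]
      rw [encodeAccCircuitList_eq_listE]
      congr 1
      apply List.ext_getElem?
      intro p
      by_cases hp : p < 3 * (succinctWidth c x.length + 2)
      · obtain ⟨h1, h2⟩ := hprint p hp
        have hp' : p < (clauseCoordList (succinctWidth c x.length)).length := by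
          rw [length_clauseCoordList]; exact hp
        rw [h2, List.getElem?_map, List.getElem?_map, List.getElem?_eq_getElem hp']
        simp only [Option.map_some, Option.some.injEq]
        congr 2
        exact congrArg _ (coordPos_getElem_clauseCoordList p hp').symm
      · rw [List.getElem?_eq_none (by rw [printA, List.length_map, List.length_range]; omega),
          List.getElem?_eq_none (by simp only [List.length_map, length_clauseCoordList]; omega)]
  · -- completeness
    intro x
    obtain ⟨E, hE, hval⟩ := hgood x
    set fams : List (List (Circuit (Fin (succinctWidth c x.length)))) :=
      (List.range (nFam c x.length)).map fun φ => (List.range (NVn c M pT x.length)).map (E φ) with hfams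
    have hflat : fams.flatten = (List.range (nFam c x.length)).flatMap fun φ =>
        (List.range (NVn c M pT x.length)).map (E φ) := by
      rw [hfams, List.flatMap_def]
    have hlen : fams.length = nFam c x.length := by simp [hfams]
    have hmemE : ∀ f ∈ fams, ∀ C ∈ f, ∃ φ r, C = E φ r := by
      intro f hf C hC
      rw [hfams] at hf
      obtain ⟨φ, -, rfl⟩ := List.mem_map.1 hf
      obtain ⟨r, -, rfl⟩ := List.mem_map.1 hC
      exact ⟨φ, r, rfl⟩
    have hfam : ∀ f ∈ fams, f.length = NVn c M pT x.length ∧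
        ∀ C ∈ f, C.IsOver (accBasis m) ∧ C.acDepth ≤ d + 1 ∧ C.size ≤ qE.eval x.length := by
      intro f hf
      refine ⟨?_, fun C hC => ?_⟩
      · rw [hfams] at hf
        obtain ⟨φ, -, rfl⟩ := List.mem_map.1 hf
        simp
      · obtain ⟨φ, r, rfl⟩ := hmemE f hf C hC
        exact ⟨(hE φ r).1, (hE φ r).2.1, (hE φ r).2.2.1⟩
    obtain ⟨hokz, hcodez⟩ := stageA_complete (c := c) (m := m) (M := M) (pT := pT) (dE := d + 1) (qE := qE) x fams hlen hfam
    set z₀ := listE (listE (listE natE)) (fams.map fun f => f.map (circuitCodeList m)) with hz₀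
    have hzlen : z₀.length ≤ yp.eval x.length := by
      refine (length_guess_le m fams hlen fun f hf => ⟨(hfam f hf).1, fun C hC => ?_⟩).trans (hyp x.length)
      obtain ⟨φ, r, rfl⟩ := hmemE f hf C hC
      exact ⟨(hE φ r).2.2.1, (hE φ r).2.2.2⟩
    refine ⟨z₀, hzlen, ?_⟩
    have hDeq : D x z₀ = dnfCircuit fams.flatten (allTerms M c pT x) := by
      refine circuitCodeList_injOn m (succinctWidth c x.length) (hDclass x z₀ hzlen).1 ?_ ?_
      · refine isOver_dnfCircuit _ _ fun C hC => ?_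
        obtain ⟨f, hf, hCf⟩ := List.mem_flatten.1 hC
        exact ((hfam f hf).2 C hCf).1
      · show circuitCodeList m (D x z₀) = circuitCodeList m (dnfCircuit fams.flatten (allTerms M c pT x))
        rw [← hcodez]
        exact (stageA_sound x z₀).1.symm
    have hunsat : ¬ (D x z₀).Satisfiable := by
      rw [hDeq, satisfiable_dnfCircuit_iff, hflat]
      rintro ⟨u, hu⟩
      rw [hval u] at hu
      exact Bool.false_ne_true hu
    simp only [hok₀, hokz, hunsat, decide_false, Bool.not_false, Bool.and_self]
  · -- the total
    have h1 := hC₁ x.length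
    have h2 := satTime_le_williamsBound cS c x.length
    simp only [hτ₂]
    have e : (C₁ + cS * 2 ^ c + cS) * williamsBound x.length =
        C₁ * williamsBound x.length + cS * 2 ^ c * williamsBound x.length + cS * williamsBound x.length := by ring
    omega

end Literature.Computability.Complexity
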